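import Literature.NumberTheory.Transcendental.CurvePeriodsEllipticPathsProofs
import Literature.NumberTheory.Transcendental.SemistabilityStdOfPhilippon
import Literature.NumberTheory.Transcendental.PhilipponZeroEstimateStdProofs
import HarnessLib

/-!
# Periods of curve type: genus `0` and ARBITRARY paths on a non-CM elliptic curve — UNCONDITIONAL

Companion of `Literature/NumberTheory/Transcendental/CurvePeriods.lean` (Huber–Wüstholz 2022,
Thm. 13.3 (2) = Kontsevich's period conjecture for periods of curve type, rendered on explicit
period symbols `(Z, ω, γ)` with the elementary relations (R1)–(R5); general statement: the named
fact `HuberWustholzCurvePeriods`) and of `CurvePeriodsEllipticPathsProofs.lean`, whose theorems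
take Wüstholz's analytic subgroup theorem for `𝔾ₐ × 𝔾ₘ^ι × (E♮)^κ` at all algebraic points,
`analyticSubgroupTheorem_GaGmE`, as a hypothesis. That named fact is now a theorem of the tree
(`analyticSubgroupTheorem_GaGmE_of_philippon` of `SemistabilityStdOfPhilippon.lean` — the
Baker–Wüstholz Semistability Theorem for `M_κ` at every algebraic point followed by the dévissage
of `SemistableQuotients.lean` — applied to the discharged zero estimate `philippon1986_std_holds`
of `PhilipponZeroEstimateStdProofs.lean`; recorded as `analyticSubgroupTheorem_GaGmE_holds` in
`AnalyticSubgroupEllipticProofs.lean`), so the following case of Theorem 13.3 (2) is PROVED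
outright, with Baker's theorem, Wüstholz's analytic subgroup theorem for `𝔾ₐ × 𝔾ₘ^ι × (E♮)^κ`
and Philippon's zero estimate as its (formalized) transcendence input:

* `huberWustholzCurvePeriods_ellipticPaths_puncturedLine` — for a lattice `Λ` with algebraic
  invariants `g₂, g₃` and without complex multiplication, every vanishing `ℚ̄`-linear
  combination of period symbols supported on the affine Weierstrass curve
  `E_L : y² = x³ − (g₂/4)x − g₃/4`, on the punctured lines `Z_a = {y ∏ᵢ (x − aᵢ) = 1}`
  (`a : Fin r → ℚ̄` injective), on `𝔾ₘ = {xy = 1}` and on `𝔸¹`, all with ARBITRARY `C¹` paths with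
  algebraic end points, is a `ℚ̄`-linear combination of the elementary relations (R1)–(R5). The
  periods concerned are the `ℚ̄`-linear combinations of `1`, logarithms of algebraic numbers and
  incomplete elliptic integrals of the first and second kind between algebraic points of `E_L`
  (among them `ω₁, ω₂, η₁, η₂`) (book §13.2: "elliptic curves"; Ch. 15; §18.1–18.2).
* `huberWustholzCurvePeriods_ellipticPaths` — the same without punctured lines (support on
  `E_L`, `𝔾ₘ`, `𝔸¹`);
* `huberWustholzCurvePeriods_weierCurve_puncturedLine` — the same for the affine Weierstrass
  curve `E_{A,B} : y² = x³ + Ax + B` written in terms of `A, B` (given a lattice `L` with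
  invariants `g₂ = −4A`, `g₃ = −4B` — which exists by the Uniformization Theorem,
  `PeriodPair.uniformization_holds` of `Literature/NumberTheory/EllipticCurves/UniformizationProofs.lean`,
  not imported here — and without complex multiplication: `E_L = E_{A,B}`);
* `huberWustholzCurvePeriods_ellipticPaths_iso` — the same for every embedded smooth affine curve
  POLYNOMIALLY ISOMORPHIC over `ℚ̄` to one of `E_L`, `Z_a`, `𝔾ₘ`, `𝔸¹` (other affine models of
  the same curves: the book's `y² = 4x³ − g₂x − g₃`, conics minus points, …), by transport along
  the isomorphism (relation (R4), `exists_transport`, `span_of_transfer`).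

What is NOT here: `E_L` minus further points (incomplete integrals of the third kind), CM curves,
several pairwise non-isogenous curves, genus `≥ 2` — the general named fact
`HuberWustholzCurvePeriods`, whose printed proof goes through the analytic subgroup theorem for
arbitrary commutative algebraic groups, 1-motives and Nori motives (book Thm. 9.10, Thm. A.7).

## References

* A. Huber, G. Wüstholz, *Transcendence and Linear Relations of 1-Periods*, Cambridge Tracts in
  Mathematics 227, CUP 2022 [HuberWustholz2022]: Thm. 13.3 (2) (p. 121 of the held text), §13.2
  and Thm. 13.9 (pp. 122–125), Ch. 15, §18.1–18.2 (p. 160 ff.), Thm. 6.2.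
* G. Wüstholz, Ann. of Math. 129 (1989), 501–517 (analytic subgroup theorem). [Wustholz1989]
* A. Baker, G. Wüstholz, *Logarithmic Forms and Diophantine Geometry*, CUP 2007, Thm. 6.1,
  Thm. 6.15, §6.8. [BakerWustholz2007]
* P. Philippon, Bull. Soc. Math. France 114 (1986), 355–383, Thm. 2.1. [Philippon1986]
* A. Baker, *Transcendental Number Theory*, CUP 1975, Thm. 2.1. [Baker1975]
-/

noncomputable section

open MvPolynomial

namespace Literature.NumberTheory.Transcendental

namespace CurvePeriods

/-- **Huber–Wüstholz, Theorem 13.3 (2), for arbitrary paths on a non-CM elliptic curve together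
with `𝔾ₘ` and `𝔸¹` — PROVED.** [cite: HuberWustholz2022, Thm. 13.3 (2) (p. 121), §13.2, Ch. 15, §18.1–18.2] -/
theorem huberWustholzCurvePeriods_ellipticPaths
    (L : PeriodPair) (h₂ : IsAlgebraic ℚ L.g₂) (h₃ : IsAlgebraic ℚ L.g₃) (hCM : ¬ L.HasCM)
    (c : PeriodSymbol →₀ ℂ) (hc : ∀ s, IsAlgebraic ℚ (c s))
    (hsupp : ∀ s ∈ c.support,
      s.Z = Ell.curve L ∨ s.Z = (⟨2, 1, ![X 0 * X 1 - 1]⟩ : CurveData) ∨ s.Z = CurveData.affineLine)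
    (h0 : evalCombination c = 0) :
    ∃ (k : ℕ) (ρ : Fin k → (PeriodSymbol →₀ ℂ)) (a : Fin k → ℂ),
      (∀ l, IsElementaryRelation (ρ l)) ∧ (∀ l, IsAlgebraic ℚ (a l)) ∧ c = ∑ l, a l • ρ l :=
  huberWustholzCurvePeriods_of_ellipticPaths
    (analyticSubgroupTheorem_GaGmE_of_philippon philippon1986_std_holds) L h₂ h₃ hCM c hc hsupp h0

/-- **Huber–Wüstholz, Theorem 13.3 (2), for genus `0` (punctured lines, `𝔾ₘ`, `𝔸¹`) together with
a non-CM elliptic curve, all with arbitrary paths — PROVED.**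
[cite: HuberWustholz2022, Thm. 13.3 (2) (p. 121), §13.2, Ch. 15, §18.1–18.2] -/
theorem huberWustholzCurvePeriods_ellipticPaths_puncturedLine
    (L : PeriodPair) (h₂ : IsAlgebraic ℚ L.g₂) (h₃ : IsAlgebraic ℚ L.g₃) (hCM : ¬ L.HasCM)
    (c : PeriodSymbol →₀ ℂ) (hc : ∀ s, IsAlgebraic ℚ (c s))
    (hsupp : ∀ s ∈ c.support,
      (∃ (r : ℕ) (a : Fin r → ℂ), Function.Injective a ∧ (∀ i, IsAlgebraic ℚ (a i)) ∧
        s.Z = (⟨2, 1, ![X 1 * ∏ i, (X 0 - C (a i)) - 1]⟩ : CurveData)) ∨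
      s.Z = Ell.curve L ∨ s.Z = (⟨2, 1, ![X 0 * X 1 - 1]⟩ : CurveData) ∨ s.Z = CurveData.affineLine)
    (h0 : evalCombination c = 0) :
    ∃ (k : ℕ) (ρ : Fin k → (PeriodSymbol →₀ ℂ)) (a : Fin k → ℂ),
      (∀ l, IsElementaryRelation (ρ l)) ∧ (∀ l, IsAlgebraic ℚ (a l)) ∧ c = ∑ l, a l • ρ l :=
  huberWustholzCurvePeriods_of_puncturedLine_or_ellipticPaths
    (analyticSubgroupTheorem_GaGmE_of_philippon philippon1986_std_holds) L h₂ h₃ hCM c hc hsupp h0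

/-! ### Other models -/

/-- `E_L = E_{A,B}` when `g₂(L) = −4A` and `g₃(L) = −4B`. [folklore] -/
theorem Ell.curve_eq_weierCurve {L : PeriodPair} {A B : ℂ} (h₂ : L.g₂ = -4 * A)
    (h₃ : L.g₃ = -4 * B) : Ell.curve L = weierCurve A B := by
  have hA : Ell.A L = A := by rw [Ell.A, h₂]; ring
  have hB : Ell.B L = B := by rw [Ell.B, h₃]; ring
  change weierCurve (Ell.A L) (Ell.B L) = weierCurve A B
  rw [hA, hB]

/-- **Huber–Wüstholz, Theorem 13.3 (2), for the affine Weierstrass curve `E_{A,B} : y² = x³ + Ax + B`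
without complex multiplication, together with genus `0`, arbitrary paths — PROVED**, in terms of
`A, B`: for any lattice `L` with invariants `g₂(L) = −4A`, `g₃(L) = −4B` (one exists for all
`A, B ∈ ℂ` with `4A³ + 27B² ≠ 0` by the Uniformization Theorem, `PeriodPair.uniformization_holds`)
and without complex multiplication, `E_L = E_{A,B}` and `huberWustholzCurvePeriods_ellipticPaths_puncturedLine`
applies. [cite: HuberWustholz2022, Thm. 13.3 (2) (p. 121), §13.2, Ch. 15, §18.1–18.2] -/
theorem huberWustholzCurvePeriods_weierCurve_puncturedLine {A B : ℂ} (L : PeriodPair)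
    (hL₂ : L.g₂ = -4 * A) (hL₃ : L.g₃ = -4 * B) (hA : IsAlgebraic ℚ A) (hB : IsAlgebraic ℚ B)
    (hCM : ¬ L.HasCM)
    (c : PeriodSymbol →₀ ℂ) (hc : ∀ s, IsAlgebraic ℚ (c s))
    (hsupp : ∀ s ∈ c.support,
      (∃ (r : ℕ) (a : Fin r → ℂ), Function.Injective a ∧ (∀ i, IsAlgebraic ℚ (a i)) ∧
        s.Z = (⟨2, 1, ![X 1 * ∏ i, (X 0 - C (a i)) - 1]⟩ : CurveData)) ∨
      s.Z = weierCurve A B ∨ s.Z = (⟨2, 1, ![X 0 * X 1 - 1]⟩ : CurveData) ∨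
        s.Z = CurveData.affineLine)
    (h0 : evalCombination c = 0) :
    ∃ (k : ℕ) (ρ : Fin k → (PeriodSymbol →₀ ℂ)) (a : Fin k → ℂ),
      (∀ l, IsElementaryRelation (ρ l)) ∧ (∀ l, IsAlgebraic ℚ (a l)) ∧ c = ∑ l, a l • ρ l := by
  have h₂ : IsAlgebraic ℚ L.g₂ := by rw [hL₂]; exact ((isAlgebraic_int 4).neg).mul hA
  have h₃ : IsAlgebraic ℚ L.g₃ := by rw [hL₃]; exact ((isAlgebraic_int 4).neg).mul hB
  have hE : Ell.curve L = weierCurve A B := Ell.curve_eq_weierCurve hL₂ hL₃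
  refine huberWustholzCurvePeriods_ellipticPaths_puncturedLine L h₂ h₃ hCM c hc
    (fun s hs => ?_) h0
  rw [hE]
  exact hsupp s hs

/-- **… and for every curve polynomially isomorphic over `ℚ̄` to `E_L`, to a punctured line, to `𝔾ₘ`
or to `𝔸¹`** (arbitrary `C¹` paths with algebraic end points; e.g. the model
`y² = 4x³ − g₂x − g₃` of the book, `y p(x) = 1` for any square-free `p ∈ ℚ̄[x]`, conics minus
points): transport along the isomorphism by (R4) (`exists_transport`, `span_of_transfer`), then
`huberWustholzCurvePeriods_ellipticPaths_puncturedLine`.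
[cite: HuberWustholz2022, Thm. 13.3 (2) (p. 121), §13.1 (B) (p. 120), §13.2] -/
theorem huberWustholzCurvePeriods_ellipticPaths_iso
    (L : PeriodPair) (h₂ : IsAlgebraic ℚ L.g₂) (h₃ : IsAlgebraic ℚ L.g₃) (hCM : ¬ L.HasCM)
    (c : PeriodSymbol →₀ ℂ) (hc : ∀ s, IsAlgebraic ℚ (c s))
    (hiso : ∀ s ∈ c.support, ∃ Z₀ : CurveData,
      ((∃ (r : ℕ) (a : Fin r → ℂ), Function.Injective a ∧ (∀ i, IsAlgebraic ℚ (a i)) ∧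
          Z₀ = (⟨2, 1, ![X 1 * ∏ i, (X 0 - C (a i)) - 1]⟩ : CurveData)) ∨
        Z₀ = Ell.curve L ∨ Z₀ = (⟨2, 1, ![X 0 * X 1 - 1]⟩ : CurveData) ∨
          Z₀ = CurveData.affineLine) ∧
      Z₀.IsSmoothAffineCurve ∧
      ∃ (φ : Fin s.Z.n → MvPolynomial (Fin Z₀.n) ℂ) (ψ : Fin Z₀.n → MvPolynomial (Fin s.Z.n) ℂ),
        (∀ j, HasAlgCoeffs (φ j)) ∧ (∀ i, HasAlgCoeffs (ψ i)) ∧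
          (∀ x ∈ Z₀.points, (fun j => eval x (φ j)) ∈ s.Z.points) ∧
          (∀ z ∈ s.Z.points, (fun i => eval z (ψ i)) ∈ Z₀.points) ∧
          (∀ z ∈ s.Z.points, (fun j => eval (fun i => eval z (ψ i)) (φ j)) = z))
    (h0 : evalCombination c = 0) :
    ∃ (k : ℕ) (ρ : Fin k → (PeriodSymbol →₀ ℂ)) (a : Fin k → ℂ),
      (∀ l, IsElementaryRelation (ρ l)) ∧ (∀ l, IsAlgebraic ℚ (a l)) ∧ c = ∑ l, a l • ρ l := by
  classical
  have key : ∀ s : PeriodSymbol, ∃ s₁ : PeriodSymbol, s ∈ c.support →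
      (((∃ (r : ℕ) (a : Fin r → ℂ), Function.Injective a ∧ (∀ i, IsAlgebraic ℚ (a i)) ∧
          s₁.Z = (⟨2, 1, ![X 1 * ∏ i, (X 0 - C (a i)) - 1]⟩ : CurveData)) ∨
        s₁.Z = Ell.curve L ∨ s₁.Z = (⟨2, 1, ![X 0 * X 1 - 1]⟩ : CurveData) ∨
          s₁.Z = CurveData.affineLine) ∧
        IsElementaryRelation (Finsupp.single s₁ 1 - Finsupp.single s 1)) := by
    intro s
    by_cases hs : s ∈ c.support
    · obtain ⟨Z₀, hZ₀, hsm, φ, ψ, hφ, hψ, hφZ, hψZ, hinv⟩ := hiso s hs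
      obtain ⟨γ, _, hrel⟩ := exists_transport hsm s.smooth φ hφ hφZ ψ hψ hψZ hinv s.ω
        s.ω_algebraic s.γ
      exact ⟨_, fun _ => ⟨hZ₀, hrel⟩⟩
    · exact ⟨s, fun h => (hs h).elim⟩
  choose T hT using key
  exact span_of_transfer c hc T (fun s hs => (hT s hs).2)
    (fun s => (∃ (r : ℕ) (a : Fin r → ℂ), Function.Injective a ∧ (∀ i, IsAlgebraic ℚ (a i)) ∧
        s.Z = (⟨2, 1, ![X 1 * ∏ i, (X 0 - C (a i)) - 1]⟩ : CurveData)) ∨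
      s.Z = Ell.curve L ∨ s.Z = (⟨2, 1, ![X 0 * X 1 - 1]⟩ : CurveData) ∨
        s.Z = CurveData.affineLine)
    (fun s hs => (hT s hs).1)
    (fun c' hc' hsupp h0' =>
      huberWustholzCurvePeriods_ellipticPaths_puncturedLine L h₂ h₃ hCM c' hc' hsupp h0') h0

end CurvePeriods

end Literature.NumberTheory.Transcendental

end
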